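import Mathlib
import Literature.LinearAlgebra.Matrix.RankMinors
import Summits.ValiantsHypothesis.ValiantsHypothesis.Theorems.BarrierLeverSuccinctHittingSetsForVPExplicitGenerator

/-!
# Route BarrierLever — crux `DefinableEquations` (stmt-8745) / item `SingleSizeEquations`
# (stmt-8749): UNION REDUCTION for coordinate rank methods — one small circuit maximises EVERY
# coordinate-matrix rank over `SmallCircuits ℂ n b` at once; unions of rank thresholds never help
# beyond `b ↦ 5b + 23` (val-np-p5 g10)

Every natural proof on the model axis and every wall of val-np-p5 g3–g10 is a COORDINATE RANK
METHOD, possibly used as a UNION over a family of shapes ("every `f` in the class has SOME deficient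
flattening": Raz's full rank over all balanced cuts, g4's `nisanCert`, LST over word data).  The
specialisation trick of `…GenericAffineABP.lean`, run on the tree's EXPLICIT UNIVERSAL GENERATOR
`JointGen.gen n b` (Raz's universal circuit; ONTO `coeff(SmallCircuits ℂ n b)` by
`JointGen.exists_seed_of_mem`, INTO `coeff(SmallCircuits ℂ n (5b+23))` by `JointGen.into_gen`), gives:

**Theorem (`exists_simultaneous_maximiser`).**  For `n ≥ 21876 · 2^(5b+21) + 1` and every size
bound `R` there is ONE `f ∈ SmallCircuits ℂ n (5b+23)` such that for EVERY coordinate shape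
`T : Fin r × Fin r → (monomials of degree ≤ n)`, `r ≤ R`, and EVERY `g ∈ SmallCircuits ℂ n b`:
`rank M_T(g) ≤ rank M_T(f)`.  (For each of the finitely many shapes pick a member of the class of
maximal rank (`Nat.findGreatest`), a seed mapping to it, a nonzero minor of the generic matrix
`(gen_{T i j})` in the seed variables; avoid the product of these polynomials; land the good seed
INTO the class `5b+23`.)

**Corollary (`union_reduction`).**  If a UNION coordinate rank method `(T_i, s_i)_{i ∈ ι}` (any
index type, sizes `≤ R`) is useful against `SmallCircuits ℂ n (5b+23)` — every member has SOME
`i` with `rank M_{T_i} < s_i` — then SOME SINGLE shape `(T_i, s_i)` is already useful against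
`SmallCircuits ℂ n b`.  Contrapositively (`union_useless_of_single_saturated`): if every single
shape of the family is SATURATED inside `SmallCircuits ℂ n b` (some member reaches its
threshold — as the PD / Nisan-cut / Kalorkoti / LST walls show for their shapes at `b ≤ 5`), then
NO union over the family is useful against `SmallCircuits ℂ n (5b+23)`; FSV form
`not_isNaturalProof_of_zeroSet_union`.  This is method-independent: it needs no special witness
(contrast `…FullRankMethodWall.lean`, which gets the sharper exponent `3` from Raz–Yehudayoff).

What this is NOT: the exponent `5b+23` and the threshold on `n` are those of the tree's universal
generator, not optimised; a wall kills rank THRESHOLDS and their unions, not every polynomial in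
the ideal of minors; nothing on the crux (b = 2 OPEN) or `VP ≠ VNP`.  No definitions, no named
facts, standard axioms.  Refs: Raz 2010 Prop. 3.3 (universal circuit); Forbes–Shpilka–Volk 2018
Lemma 13, Def. 1/3; Raz–Yehudayoff 2008 §4 (the specialisation argument).
-/

-- `Summit.ValiantsHypothesis.ValiantsHypothesis.…` repeats a component by the D-0017 layout
-- (single-conjunct summit), which the `dupNamespace` linter flags; the name is mandated.
set_option linter.dupNamespace false

noncomputable section

namespace Summit.ValiantsHypothesis.ValiantsHypothesis.Theorems.BarrierLeverDefinableEquations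

open MvPolynomial
open Literature.Computability.AlgebraicComplexity
open Literature.Barriers.ValiantsHypothesis
open Summit.ValiantsHypothesis.ValiantsHypothesis.Theorems.BarrierLever.SuccinctHittingSetsForVP
open scoped BigOperators

namespace UnionReduction

/-- **The simultaneous maximiser.**  For `n ≥ 21876 · 2^(5b+21) + 1` and every `R` there is ONE
`f ∈ SmallCircuits ℂ n (5b+23)` with `rank M_T(g) ≤ rank M_T(f)` for every coordinate shape `T` of
size `≤ R` and every `g ∈ SmallCircuits ℂ n b`.
[cite: Raz2010, Prop. 3.3] [cite: ForbesShpilkaVolk2018, Lemma 13] -/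
theorem exists_simultaneous_maximiser {n b : ℕ} (hn : 21876 * 2 ^ (5 * b + 21) + 1 ≤ n) (R : ℕ) :
    ∃ f ∈ SmallCircuits ℂ n (5 * b + 23),
      ∀ (r : ℕ), r ≤ R → ∀ (T : Fin r → Fin r → ↥(degLEMonomials n)),
        ∀ g ∈ SmallCircuits ℂ n b,
          (Matrix.of fun i j => coeff ((T i j : ↥(degLEMonomials n)) : Fin n →₀ ℕ) g).rank ≤
          (Matrix.of fun i j => coeff ((T i j : ↥(degLEMonomials n)) : Fin n →₀ ℕ) f).rank := by
  classical
  haveI : Fintype (degLEMonomials n) := (Finsupp.finite_of_degree_le (σ := Fin n) n).fintype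
  -- per shape: a nonzero polynomial in the seeds detecting maximal rank
  have key : ∀ (r : Fin (R + 1)) (T : Fin r → Fin r → ↥(degLEMonomials n)),
      ∃ Q : MvPolynomial (Fin (JointGen.q n b)) ℂ, Q ≠ 0 ∧
        ∀ y : Fin (JointGen.q n b) → ℂ, eval y Q ≠ 0 →
          ∀ g ∈ SmallCircuits ℂ n b,
            (Matrix.of fun i j => coeff ((T i j : ↥(degLEMonomials n)) : Fin n →₀ ℕ) g).rank ≤
            (Matrix.of fun i j => eval y (JointGen.gen n b (T i j))).rank := by
    intro r T
    set m₀ := Nat.findGreatest (fun m => ∃ g ∈ SmallCircuits ℂ n b,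
      m ≤ (Matrix.of fun i j => coeff ((T i j : ↥(degLEMonomials n)) : Fin n →₀ ℕ) g).rank) r
      with hm₀
    have hle : ∀ g ∈ SmallCircuits ℂ n b,
        (Matrix.of fun i j => coeff ((T i j : ↥(degLEMonomials n)) : Fin n →₀ ℕ) g).rank ≤ m₀ := by
      intro g hg
      refine Nat.le_findGreatest ?_ ⟨g, hg, le_rfl⟩
      simpa [Fintype.card_fin] using Matrix.rank_le_card_height
        (Matrix.of fun i j => coeff ((T i j : ↥(degLEMonomials n)) : Fin n →₀ ℕ) g)
    by_cases hz : m₀ = 0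
    · refine ⟨1, one_ne_zero, fun y _ g hg => ?_⟩
      rw [hz] at hle
      exact (hle g hg).trans (Nat.zero_le _)
    · obtain ⟨g₀, hg₀, hm⟩ : ∃ g ∈ SmallCircuits ℂ n b,
          m₀ ≤ (Matrix.of fun i j => coeff ((T i j : ↥(degLEMonomials n)) : Fin n →₀ ℕ) g).rank :=
        Nat.findGreatest_of_ne_zero hm₀.symm hz
      -- a seed mapping to `g₀`
      obtain ⟨y₀, hy₀⟩ := JointGen.exists_seed_of_mem (n := n) (b := b) hg₀
      have hmat : (Matrix.of fun i j => eval y₀ (JointGen.gen n b (T i j))) =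
          Matrix.of fun i j => coeff ((T i j : ↥(degLEMonomials n)) : Fin n →₀ ℕ) g₀ := by
        ext i j
        simp only [Matrix.of_apply, hy₀]
      obtain ⟨ρ, κ, -, -, hdet⟩ :=
        Literature.LinearAlgebra.Matrix.exists_det_submatrix_ne_zero_of_le_rank _ hm
      refine ⟨((Matrix.of fun i j => JointGen.gen n b (T i j)).submatrix ρ κ).det, ?_, ?_⟩
      · intro hQ
        apply hdet
        have hev := congrArg (eval y₀) hQ
        rw [map_zero, RingHom.map_det] at hev
        rw [← hmat, ← hev]
        congr 1
      · intro y hy g hg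
        refine (hle g hg).trans (hm.trans ?_)
        have hy' : ((Matrix.of fun i j => eval y (JointGen.gen n b (T i j))).submatrix ρ κ).det ≠ 0 := by
          intro h0
          apply hy
          rw [RingHom.map_det, ← h0]
          congr 1
        rw [← hmat] at hm ⊢
        -- `rank(M(y₀)) ≥` ... we only need `rank(M(y)) ≥ m₀`-type bound via the minor
        have h1 := Literature.LinearAlgebra.Matrix.card_le_rank_of_det_submatrix_ne_zero _ ρ κ hy'
        have h2 : (Matrix.of fun i j => eval y₀ (JointGen.gen n b (T i j))).rank ≤ m₀ := by
          rw [hmat]; exact hle g₀ hg₀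
        simp only [Fintype.card_fin] at h1
        exact h2.trans h1
  choose Q hQ0 hQ using key
  have hprod : (∏ w : (Σ r : Fin (R + 1), (Fin r → Fin r → ↥(degLEMonomials n))), Q w.1 w.2) ≠ 0 :=
    Finset.prod_ne_zero_iff.2 fun w _ => hQ0 _ _
  obtain ⟨ystar, hy⟩ : ∃ y : Fin (JointGen.q n b) → ℂ,
      eval y (∏ w : (Σ r : Fin (R + 1), (Fin r → Fin r → ↥(degLEMonomials n))), Q w.1 w.2) ≠ 0 := by
    by_contra h
    simp only [not_exists, not_not] at h
    exact hprod (MvPolynomial.funext fun y => by rw [map_zero]; exact h y)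
  rw [map_prod] at hy
  -- land the good seed into the class `5b+23`
  obtain ⟨f, hf, hcoeff⟩ := JointGen.into_gen (n := n) (b := b) hn ystar
  refine ⟨f, hf, fun r hr T g hg => ?_⟩
  have hw := Finset.prod_ne_zero_iff.1 hy ⟨⟨r, by omega⟩, T⟩ (Finset.mem_univ _)
  have h := hQ ⟨r, by omega⟩ T ystar hw g hg
  have hmat : (Matrix.of fun i j => eval ystar (JointGen.gen n b (T i j))) =
      Matrix.of fun i j => coeff ((T i j : ↥(degLEMonomials n)) : Fin n →₀ ℕ) f := by
    ext i j
    simp only [Matrix.of_apply, hcoeff]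
  rw [hmat] at h
  exact h

/-- **Union reduction.**  If a UNION coordinate rank method — shapes `T_i` of sizes `r_i ≤ R` with
thresholds `s_i`, `i` in any index type — is useful against `SmallCircuits ℂ n (5b+23)`
(`n ≥ 21876 · 2^(5b+21) + 1`), then some SINGLE shape of the family is useful against
`SmallCircuits ℂ n b`. [cite: ForbesShpilkaVolk2018, Def. 1 and §1] -/
theorem union_reduction {n b : ℕ} (hn : 21876 * 2 ^ (5 * b + 21) + 1 ≤ n) (R : ℕ) {ι : Type*}
    (r : ι → ℕ) (hr : ∀ i, r i ≤ R) (T : (i : ι) → Fin (r i) → Fin (r i) → ↥(degLEMonomials n))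
    (s : ι → ℕ)
    (huse : ∀ f ∈ SmallCircuits ℂ n (5 * b + 23), ∃ i : ι,
      (Matrix.of fun a c => coeff ((T i a c : ↥(degLEMonomials n)) : Fin n →₀ ℕ) f).rank < s i) :
    ∃ i : ι, ∀ g ∈ SmallCircuits ℂ n b,
      (Matrix.of fun a c => coeff ((T i a c : ↥(degLEMonomials n)) : Fin n →₀ ℕ) g).rank < s i := by
  obtain ⟨f, hf, hmax⟩ := exists_simultaneous_maximiser hn R
  obtain ⟨i, hi⟩ := huse f hf
  exact ⟨i, fun g hg => (hmax (r i) (hr i) (T i) g hg).trans_lt hi⟩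

/-- **Unions of saturated shapes are useless.**  If every shape of the family is SATURATED inside
`SmallCircuits ℂ n b` — some member `g_i ∈ SmallCircuits ℂ n b` reaches the threshold,
`s_i ≤ rank M_{T_i}(g_i)` (the content of the single-method walls) — then the union method is NOT
useful against `SmallCircuits ℂ n (5b+23)`. [cite: ForbesShpilkaVolk2018, Def. 1 and §1] -/
theorem union_useless_of_single_saturated {n b : ℕ} (hn : 21876 * 2 ^ (5 * b + 21) + 1 ≤ n)
    (R : ℕ) {ι : Type*} (r : ι → ℕ) (hr : ∀ i, r i ≤ R)
    (T : (i : ι) → Fin (r i) → Fin (r i) → ↥(degLEMonomials n)) (s : ι → ℕ)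
    (hsat : ∀ i, ∃ g ∈ SmallCircuits ℂ n b,
      s i ≤ (Matrix.of fun a c => coeff ((T i a c : ↥(degLEMonomials n)) : Fin n →₀ ℕ) g).rank) :
    ¬ ∀ f ∈ SmallCircuits ℂ n (5 * b + 23), ∃ i : ι,
      (Matrix.of fun a c => coeff ((T i a c : ↥(degLEMonomials n)) : Fin n →₀ ℕ) f).rank < s i := by
  intro huse
  obtain ⟨i, hi⟩ := union_reduction hn R r hr T s huse
  obtain ⟨g, hg, hge⟩ := hsat i
  exact absurd (hge.trans_lt (hi g hg)) (lt_irrefl _)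

/-- **FSV form.**  A polynomial `D` in the coefficient variables whose zero set on degree-`≤ n`
coefficient vectors is a union `⋃_i {rank M_{T_i} < s_i}` of coordinate-rank thresholds (sizes
`≤ R`), each saturated inside `SmallCircuits ℂ n b`, is NOT an `IsNaturalProof` against
`SmallCircuits ℂ n (5b+23)` (`n ≥ 21876 · 2^(5b+21) + 1`), in any distinguisher class.
[cite: ForbesShpilkaVolk2018, Def. 1] -/
theorem not_isNaturalProof_of_zeroSet_union {n b : ℕ} (hn : 21876 * 2 ^ (5 * b + 21) + 1 ≤ n)
    (R : ℕ) {ι : Type*} (r : ι → ℕ) (hr : ∀ i, r i ≤ R)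
    (T : (i : ι) → Fin (r i) → Fin (r i) → ↥(degLEMonomials n)) (s : ι → ℕ)
    (hsat : ∀ i, ∃ g ∈ SmallCircuits ℂ n b,
      s i ≤ (Matrix.of fun a c => coeff ((T i a c : ↥(degLEMonomials n)) : Fin n →₀ ℕ) g).rank)
    (𝒟 : Set (MvPolynomial (degLEMonomials n) ℂ)) (D : MvPolynomial (degLEMonomials n) ℂ)
    (hD : ∀ g : MvPolynomial (Fin n) ℂ, g.totalDegree ≤ n →
      (eval (coeffVector (degLEMonomials n) g) D = 0 ↔
        ∃ i : ι, (Matrix.of fun a c =>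
          coeff ((T i a c : ↥(degLEMonomials n)) : Fin n →₀ ℕ) g).rank < s i)) :
    ¬ IsNaturalProof (degLEMonomials n) (SmallCircuits ℂ n (5 * b + 23)) 𝒟 D := by
  rintro ⟨-, -, hvan⟩
  exact union_useless_of_single_saturated hn R r hr T s hsat fun f hf => (hD f hf.1).1 (hvan f hf)

end UnionReduction

end Summit.ValiantsHypothesis.ValiantsHypothesis.Theorems.BarrierLeverDefinableEquations
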